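import Summits.QuantumFields.BalabanUV.Beta.GAN24.TorusCoveringRowSum
import Summits.QuantumFields.BalabanUV.Beta.GAN24.Entry115SupCubic

/-!
# G-an2-4 ∕ (CONV-C), INTERFACE REQUEST #12 (B5-1115-TABLE), rows F12-E2r ∕ F12-E3 (rect.) ∕ F12-E4 (rect.) — THE ENDS:
# [B5] (1.110) ENTRIES 2, 3, 4 «|(∇GJ)(x)|, |(G∇*J)(x)|, |(ΔGJ)(x)| ≤ O(1)e^{−δ₀|y−y′|}|J|» FOR `G = Δ_1⁻¹ = (DeltaA n M 1)⁻¹`,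
# `U = 1`, `a = 1`, ON EVERY TORUS `M` (RECTANGULAR INCLUDED), UNIFORMLY IN THE SPACING — THE NAMED STATEMENTS `Entry110Grad d 1`,
# `Entry110GDiv d 1`, `Entry110Lap d 1` DISCHARGED (+ the (1.115) global sup entries 2–4 on every torus)

G-an2-4 formalisation swarm `b2b-balaban-gan24-formalise-*`, leaf prover 02 (gen 42), crux team (2) under the coordinator ruling
«YM REDIRECT» (e34b3e0c).  WHY THIS FILE — the road-P2 crux prover's **INTERFACE REQUEST G-an2-4: (B5-1115-TABLE)** (unit
`b2b-balaban-gan24-p2` gen 28, `HOME/INBOX.md` 2026-08-21T05:44Z) asks for (E2) «for `G := (DeltaA n M a)⁻¹` at U = 1, constants in `d`,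
`a` only, UNIFORM IN `n = L^k` AND IN THE TORUS `M`».  Leaf 01 (gen 53) typed it as `B5Prop12Entries110.Entry110Grad d a` (p250927, ∀ `M`);
leaf 04 (gen 46) proved it — and the third and fourth entries `Entry110GDiv`, `Entry110Lap` — at `a = 1` on every CUBIC torus
(`Entry110GradCubic.block_row_sum_fdiff_inv_le_cubic`, `Entry110GDivCubic.block_row_sum_inv_fdiffH_le_cubic`,
`Entry110LapCubic.block_row_sum_Lap_mul_inv_le_cubic`; NE3 ∕ NE2-leaf-05 chain) and reduced each named statement to a per-block row bound on
every torus (`entry110Grad_of_block_row_sum`, `entry110GDiv_of_block_row_sum`, `entry110Lap_of_block_row_sum`).  THIS FILE closes the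
three named statements at `a = 1` for EVERY torus by the COVERING BRIDGE of this lineage (§ II.F row F12-E2r, road (r2)): the rectangular torus
`Π_μ ℤ/(n·M_μ)` is covered by the cubic torus of unit side `P = Π_μ M_μ`; `∇_ν·Δ_1⁻¹` commutes with the pull-back
(`TorusCoveringOps.entryGrad_mul_pullV` ∕ `entryGDiv_mul_pullV` ∕ `entryLap_mul_pullV`: every factor of `DeltaA`, including the non-local
`PcT`, intertwines — `Δ⁻¹` by its algebraic characterisation, inverses by `itw_inv`); so each rectangular kernel is the deck sum of the cubic
kernel and leaf 04's cubic per-block bounds descend with constants `(B·periodConst δ d, δ/(d+1))` (`TorusCoveringRowSum.block_row_bound_transfer`,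
`TorusCoveringDeckSum.deck_sum_le`).

## Contents (0 `def`, 0 `def … : Prop`, 0 cite, 0 sorry)
* `block_row_sum_fdiff_inv_le`, `block_row_sum_inv_fdiffH_le`, `block_row_sum_Lap_mul_inv_le` — the per-block row bounds for `∇_ν·Δ_1⁻¹`,
  `Δ_1⁻¹·∇_ν*`, `Δ·Δ_1⁻¹` on EVERY torus, every spacing (constants: NE3's via leaf 04, times `periodConst`, rate `/(d+1)`).
* ENDS **`entry110Grad_one : Entry110Grad d 1`**, **`entry110GDiv_one : Entry110GDiv d 1`**, **`entry110Lap_one : Entry110Lap d 1`** — the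
  named entries 2, 3, 4 of (1.110) at `a = 1`, all tori, all spacings.
* §4 the (1.115) GLOBAL sup entries 2–4 on EVERY torus (`norm_fdiff_inv_mulVec_le`, `norm_inv_fdiffH_mulVec_le`, `norm_Lap_inv_mulVec_le`):
  leaf 04's `Entry115SupCubic` ENDs with the torus general, over its any-torus `norm_mulVec_le_of_block_row_sum` BY NAME.

HONEST SCOPE.  (i) `a = 1`, `U = 1`; unit cubes `B` in place of the printed doubled cubes `Δ̃` (as in p250927 and the landed first entry).
(ii) The ONLY analytic input is leaf 04's cubic theorem (NE3's heat-kernel free gradient + resolvent identity, pv15's block resummation,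
NE2-leaf-05's transport); this lineage adds finite bookkeeping (coverings of tori) and one elementary deck sum.  (iii) Constants: NE3's
existential `(B₁, δ)(d)` become `(B₁·periodConst δ d, δ/(d+1))` — still functions of `d` only.  (iv) Nothing printed is asserted — [B5]
`Balaban1984PropagatorsI` Prop. 1.2 (1.110) p. 35 is a TEXT LOCATION; (1.5) p. 18 (periodic boundary conditions on an arbitrary torus) is
why every `M` is a legitimate `T_η`.  (v) The first entry `Entry110G d 1` was already proved for every torus (`B5Prop12Entries110.entry110G_one`,
pv15); the Hölder entries (1.111)–(1.117), the projection part (E_P) and every `a ≠ 1` are untouched.  NOT (CONV-C),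
NEVER «G-an2-4 closed», NOT NE2 ∕ NE3, NOT D1, NOT BetaPertH, NOT continuum, NOT Clay; not in print — our bookkeeping.  ABSOLUTE RULE of the
cell kept: every input is a kernel-proved tree theorem used BY NAME.  HONEST DEPENDENCY: continuum YM on T⁴ ⇐ BetaPertH ∧ nine spine
estimates (0/9 proved); BetaPertH ⇐ (D1) ∧ (D4) ∧ CAP+tail; G-an2-4 gates asym, D1 and NE2/3/4.
-/

noncomputable section

open scoped BigOperators Matrix
open Finset

namespace Summit.QuantumFields.BalabanUV.Beta.GAN24.Entry110Rect

open Literature.MathematicalPhysics.QuantumFieldTheory.Balaban1983to89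
open B5Prop11Plancherel (Tor fine fdiff)
open B5Blocks16 (blockOf)
open B5Prop11Lower (Lap)
open B5DeltaA169 (DeltaA)
open B4TorusKernel (periodConst)
open B4TorusKernel.MultiPeriod (torusSupNorm)
open B5Kernel166Decay (periodConst_pos)
open B6LowerBound2153Torus (rep)
open B5Prop12Entries110 (Entry110Grad Entry110GDiv Entry110Lap)
open TorusCoveringOps (entryGrad_mul_pullV entryGDiv_mul_pullV entryLap_mul_pullV)
open TorusCoveringRowSum (block_row_bound_transfer)
open Entry110GradCubic (block_row_sum_fdiff_inv_le_cubic entry110Grad_of_block_row_sum)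
open Entry110GDivCubic (block_row_sum_inv_fdiffH_le_cubic entry110GDiv_of_block_row_sum)
open Entry110LapCubic (block_row_sum_Lap_mul_inv_le_cubic entry110Lap_of_block_row_sum)
open Entry115SupCubic (norm_mulVec_le_of_block_row_sum)
open B4Sect5Proof (latticeConst latticeConst_nonneg)

variable {d : ℕ}

/-- the cubic cover: every period vector divides the constant vector of its product, and the product is nonzero. [folklore] -/
theorem dvd_prod_cover (M : Fin (d + 1) → ℕ) : ∀ μ, M μ ∣ (fun _ : Fin (d + 1) => ∏ κ, M κ) μ :=
  fun μ => Finset.dvd_prod_of_mem M (Finset.mem_univ μ)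

/-- the side of the cubic cover is nonzero. [folklore] -/
theorem prod_neZero (M : Fin (d + 1) → ℕ) [∀ μ, NeZero (M μ)] : NeZero (∏ κ, M κ) :=
  ⟨Finset.prod_ne_zero_iff.mpr fun μ _ => NeZero.ne (M μ)⟩

/-! ## §1 Entry 2: `∇_ν·Δ_1⁻¹` -/

/-- **(1.110), SECOND ENTRY `∇G`, `U = 1`, `a = 1`, PER-BLOCK ROW SUMS ON EVERY TORUS, n-UNIFORM**: there are `B, δ > 0` depending on
`d` only such that for EVERY spacing `n ≥ 1`, EVERY torus `Π_μ ℤ/M_μ`, every direction `ν`, every row `i` and every block `y′`,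
`Σ_{x′ : blockOf x′ = y′} ‖(∇_ν·Δ_1⁻¹)(i,x′)‖ ≤ B·e^{−δ·|rep(blockOf i) − rep y′|_{T₁,∞}}` — leaf 04's cubic bound at the cubic cover
`P = Π_μ M_μ`, descended along the covering. [folklore] -/
theorem block_row_sum_fdiff_inv_le :
    ∃ B δ : ℝ, 0 < B ∧ 0 < δ ∧ ∀ (n : ℕ) (M : Fin (d + 1) → ℕ) [NeZero n] [∀ μ, NeZero (M μ)],
      ∀ (ν : Fin (d + 1)) (i : Tor (fine n M) × Fin (d + 1)) (y' : Tor M),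
        ∑ x' : Tor (fine n M) × Fin (d + 1),
            (if blockOf n M x'.1 = y' then ‖(fdiff (fine n M) (n : ℂ) ν * (DeltaA n M 1)⁻¹) i x'‖ else 0)
          ≤ B * Real.exp (-(δ * torusSupNorm M (rep M (blockOf n M i.1) - rep M y'))) := by
  obtain ⟨B₁, δ, hB, hδ, hcub⟩ := block_row_sum_fdiff_inv_le_cubic (d := d)
  refine ⟨B₁ * periodConst δ d, δ / (d + 1), mul_pos hB (periodConst_pos hδ d), div_pos hδ (by positivity), ?_⟩
  intro n M _ _ ν i y'
  haveI := prod_neZero M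
  have hn : 1 ≤ n := Nat.one_le_iff_ne_zero.mpr (NeZero.ne n)
  exact block_row_bound_transfer n (dvd_prod_cover M) (entryGrad_mul_pullV n (dvd_prod_cover M) 1 hn one_pos ν) hB.le hδ
    (fun i' y'' => hcub n (∏ κ, M κ) ν i' y'') i y'

/-- **(E2) ∕ [B5] (1.110), SECOND ENTRY, AT `a = 1`, ON EVERY TORUS, UNIFORMLY IN THE SPACING — THE NAMED STATEMENT DISCHARGED**:
`B5Prop12Entries110.Entry110Grad d 1`, i.e. there are `δ₀ > 0`, `C > 0` (depending on `d` only) such that for every `n ≥ 1`, every torus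
`M`, every direction `ν`, all `y, y′ ∈ ℤ^{d+1}`, every field `J` supported in the unit cube `B(y′)` with `|J| ≤ B`, every site
`x = n·y + r` of `B(y)` and every component `μ`: `‖(∇_ν (Δ_1⁻¹ J))_μ(x)‖ ≤ C·e^{−δ₀·|y − y′|_{T₁,∞}}·B`.  (Text location: [B5]
`Balaban1984PropagatorsI` Prop. 1.2 (1.110) p. 35, second entry; the typed inequality — unit cubes, all tori, `a = 1`, NE3's constants
times `periodConst` — is ours, not a quotation.)  RATE DEGRADATION (v1.1, ref2 R193-2): the witnesses are `C = C_cubic·periodConst δ d` and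
`δ₀ = δ∕(d+1)`, `δ` = leaf 04's CUBIC rate — the deck sum over the covering (`TorusCoveringDeckSum.deck_sum_le`) costs the factor
`1∕(d+1)` in the exponent; no claim that the printed rate survives the bridge. [folklore] -/
theorem entry110Grad_one : Entry110Grad d 1 :=
  entry110Grad_of_block_row_sum 1 block_row_sum_fdiff_inv_le

/-! ## §2 Entry 3: `Δ_1⁻¹·∇_ν*` -/

/-- **(1.110), THIRD ENTRY `G∇*`, `U = 1`, `a = 1`, PER-BLOCK ROW SUMS ON EVERY TORUS, n-UNIFORM** (leaf 04's cubic bound descended).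
[folklore] -/
theorem block_row_sum_inv_fdiffH_le :
    ∃ B δ : ℝ, 0 < B ∧ 0 < δ ∧ ∀ (n : ℕ) (M : Fin (d + 1) → ℕ) [NeZero n] [∀ μ, NeZero (M μ)],
      ∀ (ν : Fin (d + 1)) (i : Tor (fine n M) × Fin (d + 1)) (y' : Tor M),
        ∑ x' : Tor (fine n M) × Fin (d + 1),
            (if blockOf n M x'.1 = y' then ‖((DeltaA n M 1)⁻¹ * (fdiff (fine n M) (n : ℂ) ν)ᴴ) i x'‖ else 0)
          ≤ B * Real.exp (-(δ * torusSupNorm M (rep M (blockOf n M i.1) - rep M y'))) := by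
  obtain ⟨B₂, δ, hB, hδ, hcub⟩ := block_row_sum_inv_fdiffH_le_cubic (d := d)
  refine ⟨B₂ * periodConst δ d, δ / (d + 1), mul_pos hB (periodConst_pos hδ d), div_pos hδ (by positivity), ?_⟩
  intro n M _ _ ν i y'
  haveI := prod_neZero M
  have hn : 1 ≤ n := Nat.one_le_iff_ne_zero.mpr (NeZero.ne n)
  exact block_row_bound_transfer n (dvd_prod_cover M) (entryGDiv_mul_pullV n (dvd_prod_cover M) 1 hn one_pos ν) hB.le hδ
    (fun i' y'' => hcub n (∏ κ, M κ) ν i' y'') i y'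

/-- **(E3) ∕ [B5] (1.110), THIRD ENTRY, AT `a = 1`, ON EVERY TORUS, UNIFORMLY IN THE SPACING — THE NAMED STATEMENT DISCHARGED**:
`B5Prop12Entries110.Entry110GDiv d 1` (`‖(Δ_1⁻¹ (∇_ν^* J))_μ(x)‖ ≤ C·e^{−δ₀·|y − y′|_{T₁,∞}}·B` for `x ∈ B(y)`, `supp J ⊆ B(y′)`,
`|J| ≤ B`).  (Text location: [B5] `Balaban1984PropagatorsI` Prop. 1.2 (1.110) p. 35, third entry; typed inequality ours.)  RATE
DEGRADATION (v1.1): witnesses `(C_cubic·periodConst δ d, δ∕(d+1))`, `δ` = leaf 04's cubic rate (deck-sum loss `1∕(d+1)`). [folklore] -/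
theorem entry110GDiv_one : Entry110GDiv d 1 :=
  entry110GDiv_of_block_row_sum 1 block_row_sum_inv_fdiffH_le

/-! ## §3 Entry 4: `Δ·Δ_1⁻¹` -/

/-- **(1.110), FOURTH ENTRY `ΔG`, `U = 1`, `a = 1`, PER-BLOCK ROW SUMS ON EVERY TORUS, n-UNIFORM** (leaf 04's cubic bound descended).
[folklore] -/
theorem block_row_sum_Lap_mul_inv_le :
    ∃ B δ : ℝ, 0 < B ∧ 0 < δ ∧ ∀ (n : ℕ) (M : Fin (d + 1) → ℕ) [NeZero n] [∀ μ, NeZero (M μ)],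
      ∀ (i : Tor (fine n M) × Fin (d + 1)) (y' : Tor M),
        ∑ x' : Tor (fine n M) × Fin (d + 1),
            (if blockOf n M x'.1 = y' then ‖(Lap n M * (DeltaA n M 1)⁻¹) i x'‖ else 0)
          ≤ B * Real.exp (-(δ * torusSupNorm M (rep M (blockOf n M i.1) - rep M y'))) := by
  obtain ⟨B₄, δ, hB, hδ, hcub⟩ := block_row_sum_Lap_mul_inv_le_cubic (d := d)
  refine ⟨B₄ * periodConst δ d, δ / (d + 1), mul_pos hB (periodConst_pos hδ d), div_pos hδ (by positivity), ?_⟩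
  intro n M _ _ i y'
  haveI := prod_neZero M
  have hn : 1 ≤ n := Nat.one_le_iff_ne_zero.mpr (NeZero.ne n)
  exact block_row_bound_transfer n (dvd_prod_cover M) (entryLap_mul_pullV n (dvd_prod_cover M) 1 hn one_pos) hB.le hδ
    (fun i' y'' => hcub n (∏ κ, M κ) i' y'') i y'

/-- **(E4) ∕ [B5] (1.110), FOURTH ENTRY, AT `a = 1`, ON EVERY TORUS, UNIFORMLY IN THE SPACING — THE NAMED STATEMENT DISCHARGED**:
`B5Prop12Entries110.Entry110Lap d 1` (`‖(Δ (Δ_1⁻¹ J))_μ(x)‖ ≤ C·e^{−δ₀·|y − y′|_{T₁,∞}}·B` for `x ∈ B(y)`, `supp J ⊆ B(y′)`, `|J| ≤ B`).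
(Text location: [B5] `Balaban1984PropagatorsI` Prop. 1.2 (1.110) p. 35, fourth entry; typed inequality ours.)  RATE DEGRADATION (v1.1):
witnesses `(C_cubic·periodConst δ d, δ∕(d+1))`, `δ` = leaf 04's cubic rate (deck-sum loss `1∕(d+1)`). [folklore] -/
theorem entry110Lap_one : Entry110Lap d 1 :=
  entry110Lap_of_block_row_sum 1 block_row_sum_Lap_mul_inv_le

/-- SHAPE CERTIFICATE: with pv15's first entry, the whole localized sup row (1.110) of [B5] Prop. 1.2 holds at `a = 1` on every torus,
uniformly in the spacing, as the four named statements of `B5Prop12Entries110`. [folklore] -/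
example : B5Prop12Entries110.Entry110G d 1 ∧ Entry110Grad d 1 ∧ Entry110GDiv d 1 ∧ Entry110Lap d 1 :=
  ⟨B5Prop12Entries110.entry110G_one d, entry110Grad_one, entry110GDiv_one, entry110Lap_one⟩

/-! ## §4 The (1.115) global sup entries 2–4 on every torus -/

/-- **(1.115), SECOND ENTRY «|∇GJ| ≤ O(1)|J|», `a = 1`, EVERY torus, n- and volume-UNIFORM**: `∃ C > 0` (function of `d`) such that for
every `n ≥ 1`, every torus `M`, every direction `ν`, every `J` with `|J| ≤ B` and every `i`: `‖(∇_ν·Δ_1⁻¹ J)(i)‖ ≤ C·B` — leaf 04's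
`Entry115SupCubic.norm_fdiff_inv_mulVec_le_cubic` with the torus general.  (Text location: [B5] `Balaban1984PropagatorsI` p. 36, (1.115);
the typed inequality is not a quotation.) [folklore] -/
theorem norm_fdiff_inv_mulVec_le :
    ∃ C : ℝ, 0 < C ∧ ∀ (n : ℕ) (M : Fin (d + 1) → ℕ) [NeZero n] [∀ μ, NeZero (M μ)] (ν : Fin (d + 1))
      (J : Tor (fine n M) × Fin (d + 1) → ℂ) (B : ℝ), (∀ j, ‖J j‖ ≤ B) →
        ∀ i : Tor (fine n M) × Fin (d + 1),
          ‖(fdiff (fine n M) (n : ℂ) ν *ᵥ ((DeltaA n M 1)⁻¹ *ᵥ J)) i‖ ≤ C * B := by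
  obtain ⟨B₁, δ, hB, hδ, hblock⟩ := block_row_sum_fdiff_inv_le (d := d)
  have hK := latticeConst_nonneg (d + 1) hδ.le
  refine ⟨B₁ * latticeConst (d + 1) δ + 1, by positivity, fun n M _ _ ν J B hJB i => ?_⟩
  have hB0 : 0 ≤ B := (norm_nonneg _).trans (hJB i)
  rw [Matrix.mulVec_mulVec]
  calc _ ≤ B₁ * latticeConst (d + 1) δ * B :=
        norm_mulVec_le_of_block_row_sum n M _ hδ (fun i' y' => hblock n M ν i' y') J hJB i
    _ ≤ (B₁ * latticeConst (d + 1) δ + 1) * B := by nlinarith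

/-- **(1.115), THIRD ENTRY «|G∇*J| ≤ O(1)|J|», `a = 1`, EVERY torus, n- and volume-UNIFORM**. [folklore] -/
theorem norm_inv_fdiffH_mulVec_le :
    ∃ C : ℝ, 0 < C ∧ ∀ (n : ℕ) (M : Fin (d + 1) → ℕ) [NeZero n] [∀ μ, NeZero (M μ)] (ν : Fin (d + 1))
      (J : Tor (fine n M) × Fin (d + 1) → ℂ) (B : ℝ), (∀ j, ‖J j‖ ≤ B) →
        ∀ i : Tor (fine n M) × Fin (d + 1),
          ‖((DeltaA n M 1)⁻¹ *ᵥ ((fdiff (fine n M) (n : ℂ) ν)ᴴ *ᵥ J)) i‖ ≤ C * B := by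
  obtain ⟨B₂, δ, hB, hδ, hblock⟩ := block_row_sum_inv_fdiffH_le (d := d)
  have hK := latticeConst_nonneg (d + 1) hδ.le
  refine ⟨B₂ * latticeConst (d + 1) δ + 1, by positivity, fun n M _ _ ν J B hJB i => ?_⟩
  have hB0 : 0 ≤ B := (norm_nonneg _).trans (hJB i)
  rw [Matrix.mulVec_mulVec]
  calc _ ≤ B₂ * latticeConst (d + 1) δ * B :=
        norm_mulVec_le_of_block_row_sum n M _ hδ (fun i' y' => hblock n M ν i' y') J hJB i
    _ ≤ (B₂ * latticeConst (d + 1) δ + 1) * B := by nlinarith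

/-- **(1.115), FOURTH ENTRY «|ΔGJ| ≤ O(1)|J|», `a = 1`, EVERY torus, n- and volume-UNIFORM**. [folklore] -/
theorem norm_Lap_inv_mulVec_le :
    ∃ C : ℝ, 0 < C ∧ ∀ (n : ℕ) (M : Fin (d + 1) → ℕ) [NeZero n] [∀ μ, NeZero (M μ)]
      (J : Tor (fine n M) × Fin (d + 1) → ℂ) (B : ℝ), (∀ j, ‖J j‖ ≤ B) →
        ∀ i : Tor (fine n M) × Fin (d + 1),
          ‖(Lap n M *ᵥ ((DeltaA n M 1)⁻¹ *ᵥ J)) i‖ ≤ C * B := by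
  obtain ⟨B₄, δ, hB, hδ, hblock⟩ := block_row_sum_Lap_mul_inv_le (d := d)
  have hK := latticeConst_nonneg (d + 1) hδ.le
  refine ⟨B₄ * latticeConst (d + 1) δ + 1, by positivity, fun n M _ _ J B hJB i => ?_⟩
  have hB0 : 0 ≤ B := (norm_nonneg _).trans (hJB i)
  rw [Matrix.mulVec_mulVec]
  calc _ ≤ B₄ * latticeConst (d + 1) δ * B :=
        norm_mulVec_le_of_block_row_sum n M _ hδ (fun i' y' => hblock n M i' y') J hJB i
    _ ≤ (B₄ * latticeConst (d + 1) δ + 1) * B := by nlinarith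

end Summit.QuantumFields.BalabanUV.Beta.GAN24.Entry110Rect

end
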